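import Literature.MathematicalPhysics.QuantumFieldTheory.Balaban1983to89.T3UnitScaleTilt
import Literature.MathematicalPhysics.QuantumFieldTheory.Balaban1983to89.T3UnitLawDensityEML
import Literature.MathematicalPhysics.QuantumFieldTheory.Balaban1983to89.WilsonLoopLimit
import Literature.MathematicalPhysics.QuantumFieldTheory.Balaban1983to89.T4PairDerivBridge
import HarnessLib

/-!
# Crux `UnitScaleTilt.HistoryTailL` (stmt-QuantumFields-19936), LINES 17/18 (routes `RectangleDomination` / `RandomisedStokes`,
# planner ym-r3-idea-2 g8): the REGISTERED STUB `stub_tail_of_moments : RectMomentsL → RectangleTailL` — BY NAME AND SIGNATURE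

Skeleton `Cruxes/HistoryTailL/Lines/randomised_stokes.lean` (sha 55c6af24…, registered 2026-08-29T00:44Z) types the perimeter-law
moderate-deviation tail of ONE finest contractible rectangular Wilson loop (`RectangleTailL`, item stmt-QuantumFields-23864, shared by
LINES 17 and 18) as the composition of sub-Gaussian perimeter-law MOMENTS (`RectMomentsL`, the hard stub `stub_rectMoments`, OPEN) and a
Markov optimisation (`stub_tail_of_moments`, this file).

THE ARGUMENT (elementary).  §1: for a non-negative bounded measurable `X` on a probability space with moments
`E[Xⁿ] ≤ M·(n·s)^{n/2}` (`n ≥ 1`), Markov's inequality at the moment `n = ⌊u/e⌋`, `u = t²/s`, gives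
`P(t ≤ X) ≤ max(M,1)·e^{1/2}·exp(−u/(2e))` (for `u < e` the bound exceeds `1`).  §2: with `X = dist1(hol ∂rect)`,
`M = C·β_K^A·(a+b)^A`, `s = (a+b)(1+log(a+b))/(c·β_K)` this is `RectangleTailL` with stretched exponent `α = 1`, rate `c/(2e)`,
prefactor `(C+1)·e^{1/2}·β_K^A·(a+b)^A` (`β_K ≥ 1` because `γ ≤ 1`, `a + b ≥ 2`).  §0: the registered statements verbatim
(this file's `RectMomentsL` / `RectangleTailL`, pattern of `SqueezedSkewnessEscalatorOfLogConvex`); the route decls `RectangleDomination.RectangleTailL` /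
`RandomisedStokes.RectangleTailL` (item 23864) have byte-identical bodies (`Iff.rfl` at the use site; not imported: farm snapshot lags them).

HONEST FRAMING: `RectMomentsL` (the uniform-in-cut-off perimeter-law moments of a mesoscopic SU(2) Wilson loop) is OPEN and is the
content; this file is bookkeeping.  No crux, no rung (R3 `YM3TorusSU2` is a RECORD rung) and no summit is proved; the Yang–Mills mass
gap is NOT proved by any of this.  Cell `ym-idea-1`, LEAD seat `ym-line-sfw-p2` g71 (free hands; own crux stmt-QuantumFields-22884 has no
provable delta), `--supports stmt-QuantumFields-19936`.
References: S. Chatterjee, *Yang–Mills for probabilists*, §4–5 [ChatterjeeYMProb2019] (the rectangular loop `rectLoop`). [folklore]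
-/

set_option autoImplicit false

noncomputable section

open MeasureTheory Filter Topology
open Literature.MathematicalPhysics.QuantumFieldTheory.Balaban1983to89
open Literature.MathematicalPhysics.QuantumFieldTheory.Balaban1983to89.T3ContinuumYM3Torus
open Literature.MathematicalPhysics.QuantumFieldTheory.Balaban1983to89.T3UnitScaleTilt
open Literature.MathematicalPhysics.QuantumFieldTheory.Balaban1983to89.T3UnitLawDensityEML (ℰp)

namespace Summit.QuantumFields.YangMills.Theorems.RandomisedStokesTailOfMoments

/-! ## §0 The registered statements of skeleton `randomised_stokes.lean` (sha 55c6af24…), VERBATIM -/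

/-- Registered layer-2 statement `RectMomentsL` of the skeleton (sub-Gaussian perimeter-law moments of one finest contractible rectangle),
verbatim (NOT proved here: it is the open stub `stub_rectMoments`). -/
abbrev RectMomentsL : Prop :=
  open Literature.MathematicalPhysics.QuantumFieldTheory.Balaban1983to89 Literature.MathematicalPhysics.QuantumFieldTheory.Balaban1983to89.T3ContinuumYM3Torus in ∀ (L : ℕ), ∃ (c C : ℝ) (A : ℕ), 0 < c ∧ 0 ≤ C ∧ ∀ (F : T3Family) (γ : ℝ), F.L = L → 0 < γ → γ ≤ 1 → ∀ (K a b : ℕ) (x : Site (F.P K) 0) (μ ν : Fin (F.P K).d) (n : ℕ), μ ≠ ν → 1 ≤ a → 1 ≤ b → 2 * (a + b) < (F.P K).sitesPerDir 0 → 1 ≤ n → ∫ U, (GaugeGroup.dist1 (Missing.pathHol U (Missing.rectLoop x μ ν a b))) ^ n ∂(T3UnitScaleTilt.gibbsK F T3UnitLawDensityEML.ℰp γ K) ≤ C * (F.scheme T3UnitLawDensityEML.ℰp γ).β K ^ A * ((a : ℝ) + b) ^ A * ((n : ℝ) * (((a : ℝ) + b) * (1 + Real.log ((a : ℝ) + b)))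 / (c * (F.scheme T3UnitLawDensityEML.ℰp γ).β K)) ^ ((n : ℝ) / 2)

/-- Registered statement `RectangleTailL` of the skeleton (= `Summit.QuantumFields.YangMills.Theses.RandomisedStokes.RectangleTailL`,
byte-identical body), verbatim. -/
abbrev RectangleTailL : Prop :=
  open Literature.MathematicalPhysics.QuantumFieldTheory.Balaban1983to89 Literature.MathematicalPhysics.QuantumFieldTheory.Balaban1983to89.T3ContinuumYM3Torus in ∀ (L : ℕ), ∃ (α c C : ℝ) (A : ℕ), 0 < α ∧ 0 < c ∧ 0 ≤ C ∧ ∀ (F : T3Family) (γ : ℝ), F.L = L → 0 < γ → γ ≤ 1 → ∀ (K a b : ℕ) (x : Site (F.P K) 0) (μ ν : Fin (F.P K).d) (t : ℝ), μ ≠ ν → 1 ≤ a → 1 ≤ b → 2 * (a + b) < (F.P K).sitesPerDir 0 → 0 < t → t ≤ 1 → (T3UnitScaleTilt.gibbsK F T3UnitLawDensityEML.ℰp γ K).real {U | t ≤ GaugeGroup.dist1 (Missing.pathHol U (Missing.rectLoop x μ ν a b))} ≤ C * (F.scheme T3UnitLawDensityEML.ℰp γ).β K ^ A * ((a : ℝ)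 + b) ^ A * Real.exp (-((c * (t ^ 2 * (F.scheme T3UnitLawDensityEML.ℰp γ).β K / (((a : ℝ) + b) * (1 + Real.log ((a : ℝ) + b))))) ^ α))



/-! ## §1 Markov at the optimal moment (abstract) -/

/-- **TAIL FROM SUB-GAUSSIAN-TYPE MOMENTS** (Markov at the moment `n = ⌊(t²/s)/e⌋`): if `0 ≤ X ≤ B` is measurable on a probability space
and `∫ Xⁿ ≤ M·(n·s)^{n/2}` for every `n ≥ 1` (`M ≥ 0`, `s > 0`), then for every `t > 0`
`P(t ≤ X) ≤ max(M,1)·e^{1/2}·exp(−(t²/s)/(2e))`. [folklore] -/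
theorem measureReal_le_of_moments {Ω : Type*} [MeasurableSpace Ω] (μ : Measure Ω) [IsProbabilityMeasure μ]
    {X : Ω → ℝ} (hX : Measurable X) (hX0 : ∀ ω, 0 ≤ X ω) {B : ℝ} (hXB : ∀ ω, X ω ≤ B)
    {M s : ℝ} (hM : 0 ≤ M) (hs : 0 < s)
    (hmom : ∀ n : ℕ, 1 ≤ n → ∫ ω, X ω ^ n ∂μ ≤ M * ((n : ℝ) * s) ^ ((n : ℝ) / 2))
    {t : ℝ} (ht : 0 < t) :
    μ.real {ω | t ≤ X ω} ≤ max M 1 * Real.exp (1 / 2) * Real.exp (-(t ^ 2 / s / (2 * Real.exp 1))) := by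
  set u : ℝ := t ^ 2 / s with hu_def
  have hu0 : 0 < u := div_pos (pow_pos ht 2) hs
  have he : 0 < Real.exp 1 := Real.exp_pos 1
  -- Markov at an arbitrary moment `n ≥ 1`
  have markov : ∀ n : ℕ, 1 ≤ n → μ.real {ω | t ≤ X ω} ≤ M * ((n : ℝ) / u) ^ ((n : ℝ) / 2) := by
    intro n hn
    have hint : Integrable (fun ω => X ω ^ n) μ := by
      refine Integrable.of_bound ((hX.pow_const n).aestronglyMeasurable) (B ^ n) (ae_of_all _ fun ω => ?_)
      rw [Real.norm_eq_abs, abs_of_nonneg (pow_nonneg (hX0 ω) n)]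
      exact pow_le_pow_left₀ (hX0 ω) (hXB ω) n
    have h1 : t ^ n * μ.real {ω | t ^ n ≤ X ω ^ n} ≤ ∫ ω, X ω ^ n ∂μ :=
      mul_meas_ge_le_integral_of_nonneg (ae_of_all _ fun ω => pow_nonneg (hX0 ω) n) hint (t ^ n)
    have hsub : {ω | t ≤ X ω} ⊆ {ω | t ^ n ≤ X ω ^ n} := fun ω hω => pow_le_pow_left₀ ht.le hω n
    have h2 : μ.real {ω | t ≤ X ω} ≤ μ.real {ω | t ^ n ≤ X ω ^ n} := measureReal_mono hsub (measure_ne_top _ _)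
    have htn : 0 < t ^ n := pow_pos ht n
    have h3 : μ.real {ω | t ≤ X ω} ≤ M * ((n : ℝ) * s) ^ ((n : ℝ) / 2) / t ^ n := by
      rw [le_div_iff₀ htn, mul_comm]
      exact (mul_le_mul_of_nonneg_left h2 htn.le).trans (h1.trans (hmom n hn))
    -- `(n s)^{n/2} / t^n = (n/u)^{n/2}`
    have hexp0 : (0 : ℝ) ≤ (n : ℝ) / 2 := by positivity
    have htpow : t ^ n = (t ^ 2) ^ ((n : ℝ) / 2) := by
      rw [← Real.rpow_natCast t n, ← Real.rpow_natCast t 2, ← Real.rpow_mul ht.le]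
      congr 1; push_cast; ring
    have hkey : ((n : ℝ) * s) ^ ((n : ℝ) / 2) / t ^ n = ((n : ℝ) / u) ^ ((n : ℝ) / 2) := by
      rw [htpow, ← Real.div_rpow (by positivity) (by positivity)]
      congr 1
      rw [hu_def]; field_simp
    calc μ.real {ω | t ≤ X ω} ≤ M * ((n : ℝ) * s) ^ ((n : ℝ) / 2) / t ^ n := h3
      _ = M * (((n : ℝ) * s) ^ ((n : ℝ) / 2) / t ^ n) := by ring
      _ = M * ((n : ℝ) / u) ^ ((n : ℝ) / 2) := by rw [hkey]
  have hmax1 : (1 : ℝ) ≤ max M 1 := le_max_right _ _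
  have hmax0 : (0 : ℝ) ≤ max M 1 := zero_le_one.trans hmax1
  by_cases hue : Real.exp 1 ≤ u
  · -- the optimal moment `n = ⌊u/e⌋ ≥ 1`
    set n : ℕ := ⌊u / Real.exp 1⌋₊ with hn_def
    have hue1 : 1 ≤ u / Real.exp 1 := by rwa [le_div_iff₀ he, one_mul]
    have hn1 : 1 ≤ n := by
      rw [hn_def]; exact_mod_cast (Nat.one_le_floor_iff _).mpr hue1
    have hnle : (n : ℝ) ≤ u / Real.exp 1 := Nat.floor_le (zero_le_one.trans hue1)
    have hnlt : u / Real.exp 1 < (n : ℝ) + 1 := Nat.lt_floor_add_one _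
    -- `n/u ≤ e⁻¹`
    have hratio : (n : ℝ) / u ≤ Real.exp (-1) := by
      rw [div_le_iff₀ hu0, Real.exp_neg, ← div_eq_inv_mul]
      exact hnle
    have hpow : ((n : ℝ) / u) ^ ((n : ℝ) / 2) ≤ Real.exp (-1) ^ ((n : ℝ) / 2) :=
      Real.rpow_le_rpow (by positivity) hratio (by positivity)
    have hpow' : Real.exp (-1) ^ ((n : ℝ) / 2) = Real.exp (-((n : ℝ) / 2)) := by
      rw [← Real.exp_mul]; congr 1; ring
    -- `exp(−n/2) ≤ e^{1/2}·exp(−u/(2e))` since `n > u/e − 1`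
    have hcmp : Real.exp (-((n : ℝ) / 2)) ≤ Real.exp (1 / 2) * Real.exp (-(u / (2 * Real.exp 1))) := by
      rw [← Real.exp_add]
      refine Real.exp_le_exp.mpr ?_
      have : u / (2 * Real.exp 1) = (u / Real.exp 1) / 2 := by ring
      rw [this]
      linarith
    calc μ.real {ω | t ≤ X ω} ≤ M * ((n : ℝ) / u) ^ ((n : ℝ) / 2) := markov n hn1
      _ ≤ M * (Real.exp (1 / 2) * Real.exp (-(u / (2 * Real.exp 1)))) := by
          refine mul_le_mul_of_nonneg_left ?_ hM
          exact hpow.trans (hpow' ▸ hcmp)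
      _ ≤ max M 1 * (Real.exp (1 / 2) * Real.exp (-(u / (2 * Real.exp 1)))) :=
          mul_le_mul_of_nonneg_right (le_max_left _ _) (by positivity)
      _ = max M 1 * Real.exp (1 / 2) * Real.exp (-(t ^ 2 / s / (2 * Real.exp 1))) := by rw [hu_def]; ring
  · -- `u < e`: the bound exceeds `1`
    rw [not_le] at hue
    have hP : μ.real {ω | t ≤ X ω} ≤ 1 := measureReal_le_one
    have hbig : (1 : ℝ) ≤ Real.exp (1 / 2) * Real.exp (-(u / (2 * Real.exp 1))) := by
      rw [← Real.exp_add]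
      refine Real.one_le_exp ?_
      have : u / (2 * Real.exp 1) < 1 / 2 := by
        rw [div_lt_iff₀ (by positivity)]; linarith
      linarith
    calc μ.real {ω | t ≤ X ω} ≤ 1 := hP
      _ ≤ max M 1 * (Real.exp (1 / 2) * Real.exp (-(u / (2 * Real.exp 1)))) := by
          calc (1 : ℝ) = 1 * 1 := (one_mul 1).symm
            _ ≤ max M 1 * (Real.exp (1 / 2) * Real.exp (-(u / (2 * Real.exp 1)))) :=
                mul_le_mul hmax1 hbig zero_le_one hmax0
      _ = max M 1 * Real.exp (1 / 2) * Real.exp (-(t ^ 2 / s / (2 * Real.exp 1))) := by rw [hu_def]; ring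

/-! ## §2 The rectangle tail from the rectangle moments (the two route items, stated structurally) -/

/-- `1 ≤ β_K = (γL^{−K})⁻¹` on a Bałaban family when `0 < γ ≤ 1`. [folklore] -/
theorem one_le_schemeβ (F : T3Family) {γ : ℝ} (hγ : 0 < γ) (hγ1 : γ ≤ 1) (K : ℕ) :
    (1 : ℝ) ≤ (F.scheme ℰp γ).β K := by
  show (1 : ℝ) ≤ (γ * ((F.L : ℝ)⁻¹) ^ K)⁻¹
  have hL1 : (1 : ℝ) ≤ F.L := by exact_mod_cast F.hL.2.le
  have hL0 : (0 : ℝ) < F.L := one_pos.trans_le hL1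
  have hq0 : 0 < γ * ((F.L : ℝ)⁻¹) ^ K := mul_pos hγ (pow_pos (inv_pos.mpr hL0) _)
  have hq1 : γ * ((F.L : ℝ)⁻¹) ^ K ≤ 1 := by
    have h1 : ((F.L : ℝ)⁻¹) ^ K ≤ 1 := pow_le_one₀ (inv_nonneg.mpr hL0.le) (inv_le_one_of_one_le₀ hL1)
    calc γ * ((F.L : ℝ)⁻¹) ^ K ≤ 1 * 1 := mul_le_mul hγ1 h1 (pow_nonneg (inv_nonneg.mpr hL0.le) _) zero_le_one
      _ = 1 := one_mul 1
  exact (one_le_inv₀ hq0).mpr hq1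

/-- **ONE RECTANGLE: THE TAIL FROM THE MOMENTS** (`0 < γ ≤ 1`, `a + b ≥ 2`, `0 < t`): if
`∫ dist1(hol ∂rect)ⁿ dGibbs_K ≤ C·β_K^A·(a+b)^A·(n·(a+b)(1+log(a+b))/(c·β_K))^{n/2}` for every `n ≥ 1` (`C ≥ 0`, `c > 0`), then
`Gibbs_K(t ≤ dist1(hol ∂rect)) ≤ (C+1)e^{1/2}·β_K^A·(a+b)^A·exp(−(c/(2e))·t²β_K/((a+b)(1+log(a+b))))`. [folklore] -/
theorem rect_tail_of_moments (F : T3Family) {γ : ℝ} (hγ : 0 < γ) (hγ1 : γ ≤ 1) (K a b : ℕ) (hab : 2 ≤ a + b)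
    (x : Site (F.P K) 0) (μ ν : Fin (F.P K).d) {c C : ℝ} {A : ℕ} (hc : 0 < c) (hC : 0 ≤ C)
    (hmom : ∀ n : ℕ, 1 ≤ n →
      ∫ U, (GaugeGroup.dist1 (Missing.pathHol U (Missing.rectLoop x μ ν a b))) ^ n ∂(gibbsK F ℰp γ K) ≤
        C * (F.scheme ℰp γ).β K ^ A * ((a : ℝ) + b) ^ A *
          ((n : ℝ) * (((a : ℝ) + b) * (1 + Real.log ((a : ℝ) + b))) / (c * (F.scheme ℰp γ).β K)) ^ ((n : ℝ) / 2))
    {t : ℝ} (ht : 0 < t) :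
    (gibbsK F ℰp γ K).real {U | t ≤ GaugeGroup.dist1 (Missing.pathHol U (Missing.rectLoop x μ ν a b))} ≤
      ((C + 1) * Real.exp (1 / 2)) * (F.scheme ℰp γ).β K ^ A * ((a : ℝ) + b) ^ A *
        Real.exp (-((c / (2 * Real.exp 1)) *
          (t ^ 2 * (F.scheme ℰp γ).β K / (((a : ℝ) + b) * (1 + Real.log ((a : ℝ) + b)))))) := by
  haveI := isProbabilityMeasure_gibbsK F ℰp hγ.le K
  set β : ℝ := (F.scheme ℰp γ).β K with hβ_def
  set S : ℝ := ((a : ℝ) + b) * (1 + Real.log ((a : ℝ) + b)) with hS_def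
  have hβ1 : 1 ≤ β := one_le_schemeβ F hγ hγ1 K
  have hβ0 : 0 < β := one_pos.trans_le hβ1
  have hab2 : (2 : ℝ) ≤ (a : ℝ) + b := by exact_mod_cast hab
  have hab1 : (1 : ℝ) ≤ (a : ℝ) + b := by linarith
  have hlog : 0 ≤ Real.log ((a : ℝ) + b) := Real.log_nonneg hab1
  have hS0 : 0 < S := mul_pos (by linarith) (by linarith)
  -- the abstract lemma with `M = C β^A (a+b)^A`, `s = S/(cβ)`
  set M : ℝ := C * β ^ A * ((a : ℝ) + b) ^ A with hM_def
  have hM0 : 0 ≤ M := mul_nonneg (mul_nonneg hC (pow_nonneg hβ0.le A)) (pow_nonneg (by linarith) A)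
  have hs : 0 < S / (c * β) := div_pos hS0 (mul_pos hc hβ0)
  have hX : Measurable fun U : GaugeField (F.P K) 0 (Matrix.specialUnitaryGroup (Fin 2) ℂ) =>
      GaugeGroup.dist1 (Missing.pathHol U (Missing.rectLoop x μ ν a b)) :=
    RegularGaugeGroup.measurable_dist1.comp (Missing.measurable_pathHol _)
  have hmom' : ∀ n : ℕ, 1 ≤ n →
      ∫ U, (GaugeGroup.dist1 (Missing.pathHol U (Missing.rectLoop x μ ν a b))) ^ n ∂(gibbsK F ℰp γ K) ≤
        M * ((n : ℝ) * (S / (c * β))) ^ ((n : ℝ) / 2) := by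
    intro n hn
    have h := hmom n hn
    have hrw : (n : ℝ) * (S / (c * β)) = (n : ℝ) * S / (c * β) := by ring
    rw [hrw]
    simpa [hM_def, hβ_def, hS_def, mul_div_assoc] using h
  have key := measureReal_le_of_moments (gibbsK F ℰp γ K) hX (fun U => GaugeGroup.dist1_nonneg _)
    (fun U => T4PairDerivBridge.dist1_le_two_specialUnitaryGroup _) hM0 hs hmom' ht
  -- rewrite the exponent and compare the prefactors
  have hexp : t ^ 2 / (S / (c * β)) / (2 * Real.exp 1) = (c / (2 * Real.exp 1)) * (t ^ 2 * β / S) := by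
    field_simp
  rw [hexp] at key
  refine key.trans (mul_le_mul_of_nonneg_right ?_ (Real.exp_nonneg _))
  -- `max M 1 · e^{1/2} ≤ (C+1) e^{1/2} β^A (a+b)^A`
  have hx1 : (1 : ℝ) ≤ β ^ A * ((a : ℝ) + b) ^ A := one_le_mul_of_one_le_of_one_le (one_le_pow₀ hβ1) (one_le_pow₀ hab1)
  have hmax : max M 1 ≤ (C + 1) * (β ^ A * ((a : ℝ) + b) ^ A) := by
    refine max_le ?_ ?_
    · rw [hM_def, mul_assoc]
      exact mul_le_mul_of_nonneg_right (by linarith) (zero_le_one.trans hx1)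
    · calc (1 : ℝ) = 1 * 1 := (one_mul 1).symm
        _ ≤ (C + 1) * (β ^ A * ((a : ℝ) + b) ^ A) := mul_le_mul (by linarith) hx1 zero_le_one (by linarith)
  calc max M 1 * Real.exp (1 / 2) ≤ (C + 1) * (β ^ A * ((a : ℝ) + b) ^ A) * Real.exp (1 / 2) :=
        mul_le_mul_of_nonneg_right hmax (Real.exp_nonneg _)
    _ = (C + 1) * Real.exp (1 / 2) * β ^ A * ((a : ℝ) + b) ^ A := by ring

/-- **`RectMomentsL → RectangleTailL`** with the conclusion stated VERBATIM as the route item stmt-QuantumFields-23864 (the bodies of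
`Summit.QuantumFields.YangMills.Theses.RectangleDomination.RectangleTailL` and `…RandomisedStokes.RectangleTailL` are byte-identical to
this file's `RectangleTailL`: `Iff.rfl` at the use site; the route modules are not imported here only because the farm snapshot lags them),
from the moment package stated structurally: stretched exponent `α = 1`, rate `c/(2e)`, prefactor `(C+1)e^{1/2}`, same `A`.  Nothing about
the moments themselves is proved. [folklore] -/
theorem rectangleTailL_of_moments
    (hM : ∀ (L : ℕ), ∃ (c C : ℝ) (A : ℕ), 0 < c ∧ 0 ≤ C ∧ ∀ (F : T3Family) (γ : ℝ), F.L = L → 0 < γ → γ ≤ 1 →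
      ∀ (K a b : ℕ) (x : Site (F.P K) 0) (μ ν : Fin (F.P K).d) (n : ℕ), μ ≠ ν → 1 ≤ a → 1 ≤ b →
        2 * (a + b) < (F.P K).sitesPerDir 0 → 1 ≤ n →
          ∫ U, (GaugeGroup.dist1 (Missing.pathHol U (Missing.rectLoop x μ ν a b))) ^ n ∂(gibbsK F ℰp γ K) ≤
            C * (F.scheme ℰp γ).β K ^ A * ((a : ℝ) + b) ^ A *
              ((n : ℝ) * (((a : ℝ) + b) * (1 + Real.log ((a : ℝ) + b))) / (c * (F.scheme ℰp γ).β K)) ^ ((n : ℝ) / 2)) :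
    RectangleTailL := by
  intro L
  obtain ⟨c, C, A, hc, hC, h⟩ := hM L
  refine ⟨1, c / (2 * Real.exp 1), (C + 1) * Real.exp (1 / 2), A, one_pos, div_pos hc (by positivity),
    mul_nonneg (by linarith) (Real.exp_nonneg _), ?_⟩
  intro F γ hFL hγ hγ1 K a b x μ ν t hμν ha hb hab ht _ht1
  have key := rect_tail_of_moments F hγ hγ1 K a b (by omega) x μ ν hc hC
    (fun n hn => h F γ hFL hγ hγ1 K a b x μ ν n hμν ha hb hab hn) ht
  rw [Real.rpow_one]
  exact key



/-- **Registered stub `stub_tail_of_moments` of skeleton `randomised_stokes.lean` on crux stmt-QuantumFields-19936, BY NAME AND SIGNATURE: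
`RectMomentsL → RectangleTailL`** (Markov at the optimal moment; `α = 1`).  HONEST FRAMING: `RectMomentsL` is open; no crux, rung or
summit is proved; the Yang–Mills mass gap is NOT proved. [folklore] -/
theorem stub_tail_of_moments : RectMomentsL → RectangleTailL := fun hM => rectangleTailL_of_moments hM


end Summit.QuantumFields.YangMills.Theorems.RandomisedStokesTailOfMoments

end
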